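import Summits.HodgeConjecture.HodgeConjecture.Cruxes.BlochSeedDiscOne.PhaseTorusLaw

/-!
# Smeared phase-torus laws — «strengthen» lens g5 (MEMO-08 §4, 2026-08-29), kernel companion of `StrengthenSmearedTransport.lean`

Crux of record: `…Theses.EightfoldBlochSeeds.BlochSeedDiscOne` (item stmt-HodgeConjecture-18881).  NOTHING here proves HC, HC_AV,
HC_CM, H2 or 18881: these are finite harmonic-analysis theorems on the phase torus `(μ₄)⁴`, in the vocabulary of `PhaseTorusLaw.lean`
v4 (control g5 ∕ s4-prove-1 g32: `moment`, `KAdm`, `e`, `bump`, `pairing_expansion`, `rot_step` machinery), answering the brief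
«find the S⁺ whose step is a finite letter calculus like the PHASE-TORUS proof» one level up from the LINE.

DICTIONARY (MEMO-08 §4).  Off the LINE the transported top word of a clean two-term design is the SMEARED measure
`ω⁺ = Σ_x ν(x) ⊗_f m_{x_f}`, `m_ℓ = |β|δ_ζ + B·𝟙`, `B = s(s+1+|β|)/2`; its admissible moments vanish EXCEPT at the zero frequency,
where `ω̂⁺(0) = M⁺(ν)` (a class functional, `= 0` exactly on the LINE).  So the LINE hypothesis «all admissible moments vanish»
(`∀ k, KAdm k → moment ω k = 0`) weakens to `CleanOffZero ω` below, and the laws become INEQUALITIES between `μ = moment ω (1,1,1,1)`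
and the zero moment `Σ_τ ω τ`:
* `pairing_half`      — the smeared pairing identity `Σ_τ ω·F_w = Σ_τ ω + 2·Re((∏_f e(−w_f))/16 · μ)` for the half-amplitude product bumps
                         `F_w = ∏_f (1 + Re(e(−w_f) e(τ_f))) ≥ 0`;
* `smeared_down`      — DOWN orientation (`ω ≥ 0` pointwise): `|Re μ| ≤ 8·Σω` and `|Im μ| ≤ 8·Σω`            (MEMO-08 law L-DOWN; L-UP∨ is its ι-dual);
* `smeared_up`        — UP orientation (`ω ≤ ρ` pointwise, `ρ` = residual ⊗ smear): `Σω + 2Re((∏e(−w_f))/16·μ) ≤ Σ_τ ρ·F_w`   (law L-UP, direct form);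
* `transport_up` ∕ `transport_down(_nonneg)` ∕ `mass_cut_up` — the abstract TRANSPORT step (T⁺ ⇒ ω⁺ ≤ R⊗m, resp. ≥) and the mass cut
                         `Σν·w ≤ γ·w_max` (MEMO-08 L-MASS ∕ UPCUT ∕ DOWNCUT), over any finite flow;
* `smeared_joint` ∕ `smeared_joint_bound` ∕ `transport_joint` — the JOINT (monad A → N → C) law (J): ω = ρ − d_A + d_C,
                         `|μ|_∞/8 ≤ 16·Σd_A + min(M⁺, 15·M⁺)` (MEMO-08 v1.3 §4(h));
* `phaseTorusLawPos`  — HOSTED UP with non-negative zero moment: `ω ≤ 0` off `≤ 4` points, `CleanOffZero ω`, `0 ≤ Re Σω` ⟹ `μ = 0`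
                         — PT's `PhaseTorusLaw` is the case `Σω = 0`; and `hosted_up_ineq`: without the sign, `Re Σω + 2Re(e(−w)/4·P·μ) ≤ 0`
                         for the four rotations (so top-hosting alone bounds `μ` by `−Σω`, it does not kill it: MEMO-08 v1.2 §4(f)).
-/

-- the summit's nested namespace `HodgeConjecture.HodgeConjecture` is flagged on every declaration (as in the Theorems files):
set_option linter.dupNamespace false

namespace Summit.HodgeConjecture.HodgeConjecture.Cruxes.BlochSeedDiscOne.PhaseTorus

open Finset BigOperators

namespace Smeared

/-- clean OFF THE ORIGIN: every admissible non-zero frequency has vanishing moment (the zero moment is free). -/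
abbrev CleanOffZero (ω : PT → ℝ) : Prop := ∀ k, KAdm k → k ≠ 0 → moment ω k = 0

theorem cleanOffZero_of_clean {ω : PT → ℝ} (h : ∀ k, KAdm k → moment ω k = 0) : CleanOffZero ω :=
  fun k hk _ => h k hk

/-- the zero moment is the (real) total mass. -/
theorem moment_zero (ω : PT → ℝ) : moment ω 0 = ((∑ τ, ω τ : ℝ) : ℂ) := by
  unfold moment chi
  push_cast
  refine Finset.sum_congr rfl fun τ _ => ?_
  simp

/-! ## §1 half-amplitude free bumps `1 + Re(e(−w)·e(t))` (values `2,1,0,1` at `t = w, w+1, w+2, w+3`) -/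

/-- half-amplitude bump with phase `w`. -/
noncomputable def bumpHalf (w t : ZMod 4) : ℝ := bump (e (-w) / 2) t

/-- its frequency table: `1` at `0`, `e(−w)/2` at `1`, `e(w)/2` at `3`, `0` at `2`. -/
noncomputable def coefHalf (w j : ZMod 4) : ℂ :=
  if j = 0 then 1 else if j = 1 then e (-w) / 2 else if j = 3 then e w / 2 else 0

theorem coefHalf_zero (w : ZMod 4) : coefHalf w 0 = 1 := by simp [coefHalf]
theorem coefHalf_one (w : ZMod 4) : coefHalf w 1 = e (-w) / 2 := by
  simp [coefHalf, show (1 : ZMod 4) ≠ 0 from by decide]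
theorem coefHalf_two (w : ZMod 4) : coefHalf w 2 = 0 := by
  simp [coefHalf, show (2 : ZMod 4) ≠ 0 from by decide, show (2 : ZMod 4) ≠ 1 from by decide,
    show (2 : ZMod 4) ≠ 3 from by decide]
theorem coefHalf_three (w : ZMod 4) : coefHalf w 3 = e w / 2 := by
  simp [coefHalf, show (3 : ZMod 4) ≠ 0 from by decide, show (3 : ZMod 4) ≠ 1 from by decide]

theorem coefHalf_three_eq_conj (w : ZMod 4) : coefHalf w 3 = (starRingEnd ℂ) (coefHalf w 1) := by
  rw [coefHalf_three, coefHalf_one, map_div₀, ← e_neg, neg_neg, map_ofNat]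

/-- value table: `bumpHalf w t ∈ {0, 1, 2}`, in particular `0 ≤ bumpHalf w t ≤ 2`. -/
theorem bumpHalf_nonneg (w t : ZMod 4) : 0 ≤ bumpHalf w t := by
  unfold bumpHalf bump
  have harg : e (-w) / 2 * e t = e (t - w) / 2 := by rw [sub_eq_add_neg, e_add]; ring
  rw [harg]
  rcases e_cases (t - w) with h | h | h | h <;> rw [h] <;> norm_num

theorem bumpHalf_le_two (w t : ZMod 4) : bumpHalf w t ≤ 2 := by
  unfold bumpHalf bump
  have harg : e (-w) / 2 * e t = e (t - w) / 2 := by rw [sub_eq_add_neg, e_add]; ring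
  rw [harg]
  rcases e_cases (t - w) with h | h | h | h <;> rw [h] <;> norm_num

/-- character expansion of the half bump. -/
theorem bumpHalf_expand (w t : ZMod 4) :
    (bumpHalf w t : ℂ) = ∑ j : ZMod 4, coefHalf w j * Complex.I ^ ((j * t).val) := by
  change _ = ∑ j : ZMod 4, coefHalf w j * e (j * t)
  rw [sum_univ_zmod4, coefHalf_zero, coefHalf_two, coefHalf_three_eq_conj, coefHalf_one, zero_mul, e_zero,
    one_mul, one_mul, zero_mul, add_zero, three_term_eq_bump]
  rfl

/-! ## §2 the product test function with four free phases and the SMEARED PAIRING IDENTITY -/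

/-- `F_w(τ) = ∏_f bumpHalf (w f) (τ f) ≥ 0`. -/
noncomputable def Fhalf (w τ : PT) : ℝ := ∏ f, bumpHalf (w f) (τ f)

theorem Fhalf_nonneg (w τ : PT) : 0 ≤ Fhalf w τ :=
  Finset.prod_nonneg fun f _ => bumpHalf_nonneg (w f) (τ f)

theorem Fhalf_le (w τ : PT) : Fhalf w τ ≤ 16 := by
  unfold Fhalf
  calc ∏ f, bumpHalf (w f) (τ f) ≤ ∏ _f : Fin 4, (2 : ℝ) :=
        Finset.prod_le_prod (fun f _ => bumpHalf_nonneg _ _) fun f _ => bumpHalf_le_two _ _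
    _ = 16 := by norm_num

/-- the frequency-`(1,1,1,1)` coefficient of `F_w`: `(∏_f e(−w_f)) / 16`. -/
theorem prod_coefHalf_one (w : PT) : ∏ f, coefHalf (w f) 1 = (∏ f, e (-(w f))) / 16 := by
  simp only [coefHalf_one, Finset.prod_div_distrib, Finset.prod_const, Finset.card_univ, Fintype.card_fin]
  norm_num

theorem prod_coefHalf_zero (w : PT) : ∏ f, coefHalf (w f) 0 = 1 := by simp [coefHalf_zero]

theorem prod_coefHalf_three (w : PT) : ∏ f, coefHalf (w f) 3 = (starRingEnd ℂ) (∏ f, coefHalf (w f) 1) := by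
  rw [map_prod]; exact Finset.prod_congr rfl fun f _ => coefHalf_three_eq_conj (w f)

/-- **smeared pairing identity**: `Σ_τ ω τ · F_w τ = Σ_τ ω τ + 2·Re( (∏_f e(−w_f))/16 · μ )` for `ω` clean off the origin. -/
theorem pairing_half (ω : PT → ℝ) (hK : CleanOffZero ω) (w : PT) :
    ∑ τ, ω τ * Fhalf w τ = (∑ τ, ω τ) + 2 * ((∏ f, e (-(w f))) / 16 * moment ω (fun _ => 1)).re := by
  have hS := pairing_expansion ω (fun f => coefHalf (w f))
  -- reduce the frequency sum to k = 0, (1,1,1,1), (3,3,3,3)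
  have h0ne1 : (0 : PT) ≠ (fun _ => 1) := fun h => absurd (congr_fun h 0) (by decide)
  have h0ne3 : (0 : PT) ≠ (fun _ => 3) := fun h => absurd (congr_fun h 0) (by decide)
  have hne : (fun _ => (1 : ZMod 4) : PT) ≠ (fun _ => 3) := fun h => absurd (congr_fun h 0) (by decide)
  have hred : ∑ k : PT, (∏ f, coefHalf (w f) (k f)) * moment ω k =
      moment ω 0 + ((∏ f, coefHalf (w f) 1) * moment ω (fun _ => 1)
        + (∏ f, coefHalf (w f) 3) * moment ω (fun _ => 3)) := by
    rw [← Finset.add_sum_erase _ _ (Finset.mem_univ (0 : PT))]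
    congr 1
    · simp [prod_coefHalf_zero]
    · rw [Finset.sum_eq_add (fun _ => (1 : ZMod 4)) (fun _ => (3 : ZMod 4)) hne]
      · intro k hk hk'
        have hk0 : k ≠ 0 := Finset.ne_of_mem_erase hk
        by_cases h : ∃ f, k f = 2
        · obtain ⟨f, hf⟩ := h
          rw [Finset.prod_eq_zero (Finset.mem_univ f) (by rw [hf, coefHalf_two]), zero_mul]
        · rw [hK k ⟨fun f hf => h ⟨f, hf⟩, hk'.1, hk'.2⟩ hk0, mul_zero]
      · intro h; exact absurd (Finset.mem_erase.2 ⟨h0ne1.symm, Finset.mem_univ _⟩) h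
      · intro h; exact absurd (Finset.mem_erase.2 ⟨h0ne3.symm, Finset.mem_univ _⟩) h
  rw [hred, prod_coefHalf_three, moment_three_eq_conj_moment_one, ← map_mul, Complex.add_conj, moment_zero,
    prod_coefHalf_one] at hS
  have hreal : ∑ τ : PT, (ω τ : ℂ) * ∏ f, (∑ j : ZMod 4, coefHalf (w f) j * Complex.I ^ ((j * τ f).val)) =
      ((∑ τ : PT, ω τ * Fhalf w τ : ℝ) : ℂ) := by
    push_cast
    refine Finset.sum_congr rfl fun τ _ => ?_
    unfold Fhalf
    push_cast
    congr 1
    exact Finset.prod_congr rfl fun f _ => (bumpHalf_expand (w f) (τ f)).symm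
  rw [hreal] at hS
  exact_mod_cast hS

/-! ## §3 the laws -/

/-- **L-DOWN (smeared DOWN law)**: a pointwise non-negative measure, clean off the origin, has
`Σω + 2Re((∏e(−w_f))/16 · μ) ≥ 0` for every phase vector `w`. -/
theorem smeared_down (ω : PT → ℝ) (hpos : ∀ τ, 0 ≤ ω τ) (hK : CleanOffZero ω) (w : PT) :
    0 ≤ (∑ τ, ω τ) + 2 * ((∏ f, e (-(w f))) / 16 * moment ω (fun _ => 1)).re := by
  rw [← pairing_half ω hK w]
  exact Finset.sum_nonneg fun τ _ => mul_nonneg (hpos τ) (Fhalf_nonneg w τ)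

/-- the four axis rotations: `∏_f e(−w_f)` for `w = (v,0,0,0)` is `e(−v)`. -/
theorem prod_e_axis (v : ZMod 4) : ∏ f, e (-((Function.update (0 : PT) 0 v) f)) = e (-v) := by
  rw [Fin.prod_univ_four]
  simp [Function.update, e_zero]

/-- **L-DOWN, coordinates**: `|Re μ| ≤ 8 Σω` and `|Im μ| ≤ 8 Σω`. -/
theorem smeared_down_bound (ω : PT → ℝ) (hpos : ∀ τ, 0 ≤ ω τ) (hK : CleanOffZero ω) :
    |(moment ω (fun _ => 1)).re| ≤ 8 * ∑ τ, ω τ ∧ |(moment ω (fun _ => 1)).im| ≤ 8 * ∑ τ, ω τ := by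
  have key : ∀ v : ZMod 4, 0 ≤ (∑ τ, ω τ) + 2 * (e (-v) / 16 * moment ω (fun _ => 1)).re := by
    intro v
    have h := smeared_down ω hpos hK (Function.update (0 : PT) 0 v)
    rwa [prod_e_axis] at h
  have h0 := key 0
  have h1 := key 1
  have h2 := key 2
  have h3 := key 3
  rw [neg_zero, e_zero] at h0
  rw [show (-1 : ZMod 4) = 3 from by decide, e_three] at h1
  rw [show (-2 : ZMod 4) = 2 from by decide, e_two] at h2
  rw [show (-3 : ZMod 4) = 1 from by decide, e_one] at h3
  simp only [Complex.mul_re, Complex.div_re, Complex.div_im, Complex.one_re, Complex.one_im, Complex.I_re,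
    Complex.I_im, Complex.neg_re, Complex.neg_im] at h0 h1 h2 h3
  norm_num at h0 h1 h2 h3
  constructor <;> rw [abs_le] <;> constructor <;> linarith

/-- **L-UP (smeared UP law, direct form)**: `ω ≤ ρ` pointwise (ρ = residual ⊗ smear), clean off the origin ⟹
`Σω + 2Re((∏e(−w_f))/16 · μ) ≤ Σ_τ ρ τ · F_w τ` for every `w`. -/
theorem smeared_up (ω ρ : PT → ℝ) (hle : ∀ τ, ω τ ≤ ρ τ) (hK : CleanOffZero ω) (w : PT) :
    (∑ τ, ω τ) + 2 * ((∏ f, e (-(w f))) / 16 * moment ω (fun _ => 1)).re ≤ ∑ τ, ρ τ * Fhalf w τ := by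
  rw [← pairing_half ω hK w]
  exact Finset.sum_le_sum fun τ _ => mul_le_mul_of_nonneg_right (hle τ) (Fhalf_nonneg w τ)

/-- crude leak bound: `Σ_τ ρ·F_w ≤ 16·Σ_τ ρ` for `ρ ≥ 0`. -/
theorem leak_le (ρ : PT → ℝ) (hρ : ∀ τ, 0 ≤ ρ τ) (w : PT) : ∑ τ, ρ τ * Fhalf w τ ≤ 16 * ∑ τ, ρ τ := by
  rw [Finset.mul_sum]
  exact Finset.sum_le_sum fun τ _ => by
    rw [mul_comm (16 : ℝ)]
    exact mul_le_mul_of_nonneg_left (Fhalf_le w τ) (hρ τ)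

/-! ## §4 HOSTED UP: PT's covering with a free zero moment — `rot_step` with the `k = 0` term kept -/

/-- `∏_f cvec f₀ w s f 0 = 1`. -/
theorem prod_cvec_zero (f₀ : Fin 4) (w : ZMod 4) (s : Fin 4 → ZMod 4) : ∏ f, cvec f₀ w s f 0 = 1 := by
  refine Finset.prod_eq_one fun f _ => ?_
  unfold cvec; split_ifs
  · exact coefFree_zero w
  · exact coefPair_zero _

/-- **one rotation, zero moment kept**: `Re Σω + 2·Re((∏_f c_f(1))·μ) ≤ 0` when `ω ≤ 0` off the hosted box. -/
theorem rot_step_pos (ω : PT → ℝ) (A : Finset PT) (hω : ∀ τ, τ ∉ A → ω τ ≤ 0)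
    (hK : CleanOffZero ω) (f₀ : Fin 4) (s : Fin 4 → ZMod 4)
    (hbox : ∀ a ∈ A, ∃ f, f ≠ f₀ ∧ (a f = s f ∨ a f = s f + 1)) (w : ZMod 4) :
    (∑ τ, ω τ) + 2 * ((∏ f, cvec f₀ w s f 1) * moment ω (fun _ => 1)).re ≤ 0 := by
  have hS := pairing_expansion ω (cvec f₀ w s)
  have h0ne1 : (0 : PT) ≠ (fun _ => 1) := fun h => absurd (congr_fun h 0) (by decide)
  have h0ne3 : (0 : PT) ≠ (fun _ => 3) := fun h => absurd (congr_fun h 0) (by decide)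
  have hne : (fun _ => (1 : ZMod 4) : PT) ≠ (fun _ => 3) := fun h => absurd (congr_fun h 0) (by decide)
  have hred : ∑ k : PT, (∏ f, cvec f₀ w s f (k f)) * moment ω k =
      moment ω 0 + ((∏ f, cvec f₀ w s f 1) * moment ω (fun _ => 1)
        + (∏ f, cvec f₀ w s f 3) * moment ω (fun _ => 3)) := by
    rw [← Finset.add_sum_erase _ _ (Finset.mem_univ (0 : PT))]
    congr 1
    · simp [prod_cvec_zero]
    · rw [Finset.sum_eq_add (fun _ => (1 : ZMod 4)) (fun _ => (3 : ZMod 4)) hne]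
      · intro k hk hk'
        have hk0 : k ≠ 0 := Finset.ne_of_mem_erase hk
        by_cases h : ∃ f, k f = 2
        · obtain ⟨f, hf⟩ := h
          rw [Finset.prod_eq_zero (Finset.mem_univ f) (by rw [hf, cvec_two]), zero_mul]
        · rw [hK k ⟨fun f hf => h ⟨f, hf⟩, hk'.1, hk'.2⟩ hk0, mul_zero]
      · intro h; exact absurd (Finset.mem_erase.2 ⟨h0ne1.symm, Finset.mem_univ _⟩) h
      · intro h; exact absurd (Finset.mem_erase.2 ⟨h0ne3.symm, Finset.mem_univ _⟩) h
  have hc3 : ∏ f, cvec f₀ w s f 3 = (starRingEnd ℂ) (∏ f, cvec f₀ w s f 1) := by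
    rw [map_prod]; exact Finset.prod_congr rfl fun f _ => cvec_three f₀ w s f
  rw [hred, hc3, moment_three_eq_conj_moment_one, ← map_mul, Complex.add_conj, moment_zero] at hS
  have hreal : ∑ τ : PT, (ω τ : ℂ) * ∏ f, (∑ j : ZMod 4, cvec f₀ w s f j * Complex.I ^ ((j * τ f).val)) =
      ((∑ τ : PT, ω τ * ∏ f, vvec f₀ w s f (τ f) : ℝ) : ℂ) := by
    push_cast
    refine Finset.sum_congr rfl fun τ _ => ?_
    congr 1
    exact Finset.prod_congr rfl fun f _ => trig_cvec f₀ w s f (τ f)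
  have hnonpos : ∑ τ : PT, ω τ * ∏ f, vvec f₀ w s f (τ f) ≤ 0 := by
    apply Finset.sum_nonpos
    intro τ _
    by_cases hτ : τ ∈ A
    · obtain ⟨f, hf, hval⟩ := hbox τ hτ
      have h0 : ∏ f, vvec f₀ w s f (τ f) = 0 := by
        apply Finset.prod_eq_zero (Finset.mem_univ f)
        unfold vvec
        rw [if_neg hf]
        exact bumpPair_eq_zero hval
      rw [h0, mul_zero]
    · exact mul_nonpos_iff.2 (Or.inr ⟨hω τ hτ, Finset.prod_nonneg fun f _ => vvec_nonneg f₀ w s f (τ f)⟩)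
  rw [hreal] at hS
  have h2 : (∑ τ : PT, ω τ * ∏ f, vvec f₀ w s f (τ f)) =
      (∑ τ, ω τ) + 2 * ((∏ f, cvec f₀ w s f 1) * moment ω (fun _ => 1)).re := by exact_mod_cast hS
  linarith

/-- **hosted UP inequality** (any `|A| ≤ 7`, PT v4's `box_cover_seven`): for the four rotations `w`,
`Σω + 2·Re(e(−w)/4 · P · μ) ≤ 0` with `P = ∏_{f ≠ 0} conj(z_{s f})/2 ≠ 0` — top-hosting bounds `μ` by `−Σω`. -/
theorem hosted_up_ineq (ω : PT → ℝ) (A : Finset PT) (hA : A.card ≤ 7) (hω : ∀ τ, τ ∉ A → ω τ ≤ 0)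
    (hK : CleanOffZero ω) :
    ∃ P : ℂ, P ≠ 0 ∧ ‖P‖ ≤ 1 ∧ ∀ w : ZMod 4,
      (∑ τ, ω τ) + 2 * (e (-w) / 4 * P * moment ω (fun _ => 1)).re ≤ 0 := by
  obtain ⟨s, hbox⟩ := box_cover_seven A hA 0
  refine ⟨∏ f ∈ Finset.univ.erase (0 : Fin 4), (starRingEnd ℂ) (zPair (s f)) / 2, ?_, ?_, fun w => ?_⟩
  · exact Finset.prod_ne_zero_iff.2 fun f _ => div_ne_zero ((map_ne_zero _).2 (zPair_ne_zero _)) (by norm_num)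
  · calc ‖∏ f ∈ Finset.univ.erase (0 : Fin 4), (starRingEnd ℂ) (zPair (s f)) / 2‖
          = ∏ f ∈ Finset.univ.erase (0 : Fin 4), ‖(starRingEnd ℂ) (zPair (s f)) / 2‖ := norm_prod _ _
      _ ≤ ∏ _f ∈ Finset.univ.erase (0 : Fin 4), (1 : ℝ) := by
          refine Finset.prod_le_prod (fun f _ => norm_nonneg _) fun f _ => ?_
          rw [norm_div, Complex.norm_conj]
          have hz : ‖zPair (s f)‖ = Real.sqrt 2 := by
            unfold zPair
            rw [norm_mul, norm_pow, Complex.norm_I, one_pow, mul_one]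
            rw [show (-1 - Complex.I : ℂ) = ⟨-1, -1⟩ from by apply Complex.ext <;> simp]
            rw [Complex.norm_def, Complex.normSq_mk]
            norm_num
          rw [hz]
          have h2 : Real.sqrt 2 ≤ 2 := by
            rw [show (2 : ℝ) = Real.sqrt 4 from by rw [show (4:ℝ) = 2^2 from by norm_num, Real.sqrt_sq (by norm_num)]]
            exact Real.sqrt_le_sqrt (by norm_num)
          have : ‖(2 : ℂ)‖ = 2 := by simp
          rw [this, div_le_one (by norm_num : (0:ℝ) < 2)]
          exact h2
      _ = 1 := by simp
  · have h := rot_step_pos ω A hω hK 0 s hbox w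
    rw [prod_cvec_one] at h
    exact h

/-- **phase-torus law with non-negative zero moment** (corank `≤ 7`): `ω ≤ 0` off `≤ 7` points, clean OFF the origin and
`0 ≤ Σω` ⟹ `μ = 0`.  PT v4's `PhaseTorusLaw7` is the special case `Σω = moment ω 0 = 0`. -/
theorem phaseTorusLawPos (ω : PT → ℝ) (A : Finset PT) (hA : A.card ≤ 7) (hω : ∀ τ, τ ∉ A → ω τ ≤ 0)
    (hK : CleanOffZero ω) (hM : 0 ≤ ∑ τ, ω τ) : moment ω (fun _ => 1) = 0 := by
  obtain ⟨P, hPne, -, key⟩ := hosted_up_ineq ω A hA hω hK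
  have key' : ∀ w : ZMod 4, (e (-w) * (P * moment ω (fun _ => 1) / 4)).re ≤ 0 := by
    intro w
    have h := key w
    have hrw : e (-w) / 4 * P * moment ω (fun _ => 1) = e (-w) * (P * moment ω (fun _ => 1) / 4) := by ring
    rw [hrw] at h
    have : (e (-w) * (P * moment ω (fun _ => 1) / 4)).re ≤ -(∑ τ, ω τ) / 2 := by linarith
    linarith
  have hz : P * moment ω (fun _ => 1) / 4 = 0 := by
    apply eq_zero_of_re_rot_nonpos
    · have := key' 0; rwa [neg_zero, e_zero] at this
    · have := key' 3; rwa [show (-3 : ZMod 4) = 1 from by decide, e_one] at this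
    · have := key' 2; rwa [show (-2 : ZMod 4) = 2 from by decide, e_two] at this
    · have := key' 1; rwa [show (-1 : ZMod 4) = 3 from by decide, e_three] at this
  have h4 : (4 : ℂ) ≠ 0 := by norm_num
  rcases mul_eq_zero.1 ((div_eq_zero_iff.1 hz).resolve_right h4) with h | h
  · exact absurd h hPne
  · exact h

/-- PT v4's law at corank ≤ 7 is recovered (the LINE face `Σω = 0`). -/
theorem phaseTorusLaw7_of_pos : PhaseTorusLaw7 := fun ω A hA hω hK =>
  phaseTorusLawPos ω A hA hω (cleanOffZero_of_clean hK)
    (by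
      have h0 := hK 0 ⟨fun f => show (0 : ZMod 4) ≠ 2 from by decide, fun h => absurd (congr_fun h 0) (by decide),
        fun h => absurd (congr_fun h 0) (by decide)⟩
      rw [moment_zero] at h0
      have : (∑ τ, ω τ) = 0 := by exact_mod_cast h0
      rw [this])

/-- **hosted UP bound without the sign** (MEMO-08 v1.2 §4(f)): top-hosting alone gives `|Re(Pμ)|, |Im(Pμ)| ≤ −2·Σω`
(so `Σω ≤ 0`, and `μ` is bounded by the NEGATIVE zero moment, not killed). -/
theorem hosted_up_bound (ω : PT → ℝ) (A : Finset PT) (hA : A.card ≤ 7) (hω : ∀ τ, τ ∉ A → ω τ ≤ 0)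
    (hK : CleanOffZero ω) :
    ∃ P : ℂ, P ≠ 0 ∧ |(P * moment ω (fun _ => 1)).re| ≤ -(2 * ∑ τ, ω τ) ∧
      |(P * moment ω (fun _ => 1)).im| ≤ -(2 * ∑ τ, ω τ) := by
  obtain ⟨P, hPne, -, key⟩ := hosted_up_ineq ω A hA hω hK
  refine ⟨P, hPne, ?_, ?_⟩ <;> [have h0 := key 0; have h0 := key 0] <;> have h1 := key 1 <;> have h2 := key 2 <;>
    have h3 := key 3 <;>
    rw [neg_zero, e_zero] at h0 <;>
    rw [show (-1 : ZMod 4) = 3 from by decide, e_three] at h1 <;>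
    rw [show (-2 : ZMod 4) = 2 from by decide, e_two] at h2 <;>
    rw [show (-3 : ZMod 4) = 1 from by decide, e_one] at h3 <;>
    simp only [Complex.mul_re, Complex.mul_im, Complex.div_re, Complex.div_im, Complex.one_re, Complex.one_im,
      Complex.I_re, Complex.I_im, Complex.neg_re, Complex.neg_im] at h0 h1 h2 h3 ⊢ <;>
    norm_num at h0 h1 h2 h3 ⊢ <;> rw [abs_le] <;> constructor <;> nlinarith

/-! ## §5 the abstract TRANSPORT step (T⁺ ⇒ ω⁺ ≤ R⊗m): a P-saturating flow along pairs on which the weight does not increase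
bounds the weighted class sum by the weighted residual (UP); dually (DOWN) the class sum dominates the weighted residual.
Design dictionary (MEMO-08 §4(b)(d)): `P`/`N` cells with multiplicities `νP, νN ≥ 0`, flow `r y x ≥ 0` on live pairs, `Σ_x r y x = νP y`
(P saturated), residual `R x = νN x − Σ_y r y x ≥ 0`, weight = the smeared tensor `⊗_f m_{x_f}` evaluated at a torus point (antitone along
live pairs by (T⁺) = `StrengthenSmearedTransport.smear_monotone` + `tensor_mono4`). -/

/-- **transport inequality, UP**: if the weight does not increase along every pair that carries flow, then
`Σ_N νN·w − Σ_P νP·w ≤ Σ_N R·w` (no sign assumption on `w`). -/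
theorem transport_up {ι κ : Type*} [Fintype ι] [Fintype κ] (νP wP : ι → ℝ) (νN wN : κ → ℝ) (r : ι → κ → ℝ)
    (hr : ∀ y x, 0 ≤ r y x) (hsat : ∀ y, ∑ x, r y x = νP y) (hmono : ∀ y x, 0 < r y x → wN x ≤ wP y) :
    (∑ x, νN x * wN x) - ∑ y, νP y * wP y ≤ ∑ x, (νN x - ∑ y, r y x) * wN x := by
  have hkey : ∑ x, (∑ y, r y x) * wN x ≤ ∑ y, νP y * wP y := by
    calc ∑ x, (∑ y, r y x) * wN x = ∑ y, ∑ x, r y x * wN x := by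
            rw [Finset.sum_comm]; exact Finset.sum_congr rfl fun x _ => Finset.sum_mul _ _ _
      _ ≤ ∑ y, ∑ x, r y x * wP y := by
            refine Finset.sum_le_sum fun y _ => Finset.sum_le_sum fun x _ => ?_
            rcases (hr y x).eq_or_lt with h | h
            · rw [← h, zero_mul, zero_mul]
            · exact mul_le_mul_of_nonneg_left (hmono y x h) (hr y x)
      _ = ∑ y, νP y * wP y := Finset.sum_congr rfl fun y _ => by rw [← Finset.sum_mul, hsat y]
  have hsplit : ∑ x, (νN x - ∑ y, r y x) * wN x = (∑ x, νN x * wN x) - ∑ x, (∑ y, r y x) * wN x := by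
    rw [← Finset.sum_sub_distrib]; exact Finset.sum_congr rfl fun x _ => by ring
  rw [hsplit]; linarith

/-- **transport inequality, DOWN** (weight does not decrease along flow pairs): `Σ_N R·w ≤ Σ_N νN·w − Σ_P νP·w`;
with `R, w ≥ 0` the class sum is non-negative — the pointwise input of `smeared_down`. -/
theorem transport_down {ι κ : Type*} [Fintype ι] [Fintype κ] (νP wP : ι → ℝ) (νN wN : κ → ℝ) (r : ι → κ → ℝ)
    (hr : ∀ y x, 0 ≤ r y x) (hsat : ∀ y, ∑ x, r y x = νP y) (hmono : ∀ y x, 0 < r y x → wP y ≤ wN x) :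
    ∑ x, (νN x - ∑ y, r y x) * wN x ≤ (∑ x, νN x * wN x) - ∑ y, νP y * wP y := by
  have hkey : ∑ y, νP y * wP y ≤ ∑ x, (∑ y, r y x) * wN x := by
    calc ∑ y, νP y * wP y = ∑ y, ∑ x, r y x * wP y :=
            Finset.sum_congr rfl fun y _ => by rw [← Finset.sum_mul, hsat y]
      _ ≤ ∑ y, ∑ x, r y x * wN x := by
            refine Finset.sum_le_sum fun y _ => Finset.sum_le_sum fun x _ => ?_
            rcases (hr y x).eq_or_lt with h | h
            · rw [← h, zero_mul, zero_mul]
            · exact mul_le_mul_of_nonneg_left (hmono y x h) (hr y x)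
      _ = ∑ x, (∑ y, r y x) * wN x := by
            rw [Finset.sum_comm]; exact Finset.sum_congr rfl fun x _ => (Finset.sum_mul _ _ _).symm
  have hsplit : ∑ x, (νN x - ∑ y, r y x) * wN x = (∑ x, νN x * wN x) - ∑ x, (∑ y, r y x) * wN x := by
    rw [← Finset.sum_sub_distrib]; exact Finset.sum_congr rfl fun x _ => by ring
  rw [hsplit]; linarith

/-- DOWN positivity: residual and weights non-negative ⟹ the weighted class sum is `≥ 0`. -/
theorem transport_down_nonneg {ι κ : Type*} [Fintype ι] [Fintype κ] (νP wP : ι → ℝ) (νN wN : κ → ℝ) (r : ι → κ → ℝ)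
    (hr : ∀ y x, 0 ≤ r y x) (hsat : ∀ y, ∑ x, r y x = νP y) (hmono : ∀ y x, 0 < r y x → wP y ≤ wN x)
    (hres : ∀ x, ∑ y, r y x ≤ νN x) (hw : ∀ x, 0 ≤ wN x) :
    0 ≤ (∑ x, νN x * wN x) - ∑ y, νP y * wP y :=
  le_trans (Finset.sum_nonneg fun x _ => mul_nonneg (sub_nonneg.2 (hres x)) (hw x))
    (transport_down νP wP νN wN r hr hsat hmono)

/-- **the mass cut** (L-MASS, MEMO-08 §4(e)): UP transport + `w ≤ wmax` on residual cells + total residual `γ` ⟹ class sum `≤ γ·wmax`. -/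
theorem mass_cut_up {ι κ : Type*} [Fintype ι] [Fintype κ] (νP wP : ι → ℝ) (νN wN : κ → ℝ) (r : ι → κ → ℝ)
    (hr : ∀ y x, 0 ≤ r y x) (hsat : ∀ y, ∑ x, r y x = νP y) (hmono : ∀ y x, 0 < r y x → wN x ≤ wP y)
    (hres : ∀ x, ∑ y, r y x ≤ νN x) (wmax γ : ℝ) (hwmax : ∀ x, wN x ≤ wmax)
    (hγ : ∑ x, (νN x - ∑ y, r y x) = γ) :
    (∑ x, νN x * wN x) - ∑ y, νP y * wP y ≤ γ * wmax := by
  refine le_trans (transport_up νP wP νN wN r hr hsat hmono) ?_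
  calc ∑ x, (νN x - ∑ y, r y x) * wN x ≤ ∑ x, (νN x - ∑ y, r y x) * wmax :=
        Finset.sum_le_sum fun x _ => mul_le_mul_of_nonneg_left (hwmax x) (sub_nonneg.2 (hres x))
    _ = γ * wmax := by rw [← Finset.sum_mul, hγ]

/-! ## §6 the JOINT (monad `A → N → C`) law (MEMO-08 v1.3 §4(h)).  For a monad presentation the P-mass splits into an A-role routed UP
into N (arcs `y < x`) and a C-role served DOWN from N (arcs `x < z`); the smeared class measure decomposes POINTWISE as
`ω = ρ − d_A + d_C` with `ρ` (residual ⊗ smear), `d_A` (smear DROP along A-arcs), `d_C` (smear drop along C-arcs) all `≥ 0`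
(`transport_joint` + (T⁺)).  Pairing with `F_w ∈ [0,16]` gives the two-sided law below; pure UP is `d_C = 0`, pure DOWN is `d_A = 0`. -/

/-- **JOINT law, per phase vector**: `−16·Σd_A ≤ Σω + 2Re((∏e(−w_f))/16·μ) ≤ 16·(Σρ + Σd_C)`. -/
theorem smeared_joint (ω ρ dA dC : PT → ℝ) (hdec : ∀ τ, ω τ = ρ τ - dA τ + dC τ) (hρ : ∀ τ, 0 ≤ ρ τ)
    (hA : ∀ τ, 0 ≤ dA τ) (hC : ∀ τ, 0 ≤ dC τ) (hK : CleanOffZero ω) (w : PT) :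
    -(16 * ∑ τ, dA τ) ≤ (∑ τ, ω τ) + 2 * ((∏ f, e (-(w f))) / 16 * moment ω (fun _ => 1)).re ∧
      (∑ τ, ω τ) + 2 * ((∏ f, e (-(w f))) / 16 * moment ω (fun _ => 1)).re ≤ 16 * ((∑ τ, ρ τ) + ∑ τ, dC τ) := by
  rw [← pairing_half ω hK w]
  constructor
  · have h1 : ∑ τ, dA τ * Fhalf w τ ≤ 16 * ∑ τ, dA τ := leak_le dA hA w
    have h2 : -(∑ τ, dA τ * Fhalf w τ) ≤ ∑ τ, ω τ * Fhalf w τ := by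
      rw [← Finset.sum_neg_distrib]
      refine Finset.sum_le_sum fun τ _ => ?_
      rw [← neg_mul]
      exact mul_le_mul_of_nonneg_right (by rw [hdec τ]; linarith [hρ τ, hC τ]) (Fhalf_nonneg w τ)
    linarith
  · calc ∑ τ, ω τ * Fhalf w τ ≤ ∑ τ, (ρ τ + dC τ) * Fhalf w τ :=
          Finset.sum_le_sum fun τ _ => mul_le_mul_of_nonneg_right (by rw [hdec τ]; linarith [hA τ]) (Fhalf_nonneg w τ)
      _ ≤ 16 * ∑ τ, (ρ τ + dC τ) := leak_le _ (fun τ => add_nonneg (hρ τ) (hC τ)) w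
      _ = 16 * ((∑ τ, ρ τ) + ∑ τ, dC τ) := by rw [Finset.sum_add_distrib]

/-- **JOINT law, coordinates** (law (J) of MEMO-08 §4(h)): with `M⁺ = Σω = Σρ − Σd_A + Σd_C`,
`|Re μ|, |Im μ| ≤ 8·(16·Σd_A + M⁺)` and `≤ 8·(16·Σd_A + 15·M⁺)`, i.e. `|μ|_∞/8 ≤ 16·D_A + min(M⁺, 15 M⁺)`.
Pure DOWN (`d_A = 0`) is `smeared_down_bound`; pure UP (`d_C = 0`) is the mass form of `smeared_up`. -/
theorem smeared_joint_bound (ω ρ dA dC : PT → ℝ) (hdec : ∀ τ, ω τ = ρ τ - dA τ + dC τ) (hρ : ∀ τ, 0 ≤ ρ τ)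
    (hA : ∀ τ, 0 ≤ dA τ) (hC : ∀ τ, 0 ≤ dC τ) (hK : CleanOffZero ω) :
    |(moment ω (fun _ => 1)).re| ≤ 8 * (16 * (∑ τ, dA τ) + ∑ τ, ω τ) ∧
      |(moment ω (fun _ => 1)).re| ≤ 8 * (16 * (∑ τ, dA τ) + 15 * ∑ τ, ω τ) ∧
      |(moment ω (fun _ => 1)).im| ≤ 8 * (16 * (∑ τ, dA τ) + ∑ τ, ω τ) ∧
      |(moment ω (fun _ => 1)).im| ≤ 8 * (16 * (∑ τ, dA τ) + 15 * ∑ τ, ω τ) := by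
  have hmass : ∑ τ, ω τ = (∑ τ, ρ τ) - (∑ τ, dA τ) + ∑ τ, dC τ := by
    rw [← Finset.sum_sub_distrib, ← Finset.sum_add_distrib]; exact Finset.sum_congr rfl fun τ _ => hdec τ
  have key : ∀ v : ZMod 4, -(16 * ∑ τ, dA τ) ≤ (∑ τ, ω τ) + 2 * (e (-v) / 16 * moment ω (fun _ => 1)).re ∧
      (∑ τ, ω τ) + 2 * (e (-v) / 16 * moment ω (fun _ => 1)).re ≤ 16 * ((∑ τ, ρ τ) + ∑ τ, dC τ) := by
    intro v
    have h := smeared_joint ω ρ dA dC hdec hρ hA hC hK (Function.update (0 : PT) 0 v)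
    rwa [prod_e_axis] at h
  have h0 := key 0
  have h1 := key 1
  have h2 := key 2
  have h3 := key 3
  rw [neg_zero, e_zero] at h0
  rw [show (-1 : ZMod 4) = 3 from by decide, e_three] at h1
  rw [show (-2 : ZMod 4) = 2 from by decide, e_two] at h2
  rw [show (-3 : ZMod 4) = 1 from by decide, e_one] at h3
  simp only [Complex.mul_re, Complex.div_re, Complex.div_im, Complex.one_re, Complex.one_im, Complex.I_re,
    Complex.I_im, Complex.neg_re, Complex.neg_im] at h0 h1 h2 h3
  norm_num at h0 h1 h2 h3
  obtain ⟨h0a, h0b⟩ := h0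
  obtain ⟨h1a, h1b⟩ := h1
  obtain ⟨h2a, h2b⟩ := h2
  obtain ⟨h3a, h3b⟩ := h3
  refine ⟨?_, ?_, ?_, ?_⟩ <;> rw [abs_le] <;> constructor <;> linarith

/-- **JOINT transport bookkeeping** (design level): A-flow `rA` saturating `νA` UP into N, C-flow `rC` saturating `νC` DOWN from N,
residual `R x = νN x − Σ_y rA y x − Σ_z rC x z`; then for ANY weights
`Σ_N νN·w − Σ_A νA·w − Σ_C νC·w = Σ_N R·w − Σ_{A-arcs} rA·(w_A y − w_N x) + Σ_{C-arcs} rC·(w_N x − w_C z)`.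
With the smeared tensor as weight, (T⁺) makes both bracketed differences `≥ 0` pointwise on the torus (the `d_A`, `d_C` of `smeared_joint`). -/
theorem transport_joint {ιA ιC κ : Type*} [Fintype ιA] [Fintype ιC] [Fintype κ]
    (νA wA : ιA → ℝ) (νC wC : ιC → ℝ) (νN wN : κ → ℝ) (rA : ιA → κ → ℝ) (rC : κ → ιC → ℝ)
    (hsatA : ∀ y, ∑ x, rA y x = νA y) (hsatC : ∀ z, ∑ x, rC x z = νC z) :
    (∑ x, νN x * wN x) - (∑ y, νA y * wA y) - (∑ z, νC z * wC z) =
      (∑ x, (νN x - ∑ y, rA y x - ∑ z, rC x z) * wN x)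
        - (∑ y, ∑ x, rA y x * (wA y - wN x)) + (∑ x, ∑ z, rC x z * (wN x - wC z)) := by
  have h1 : ∑ y, νA y * wA y = ∑ y, ∑ x, rA y x * wA y :=
    Finset.sum_congr rfl fun y _ => by rw [← hsatA y, Finset.sum_mul]
  have h2 : ∑ z, νC z * wC z = ∑ x, ∑ z, rC x z * wC z := by
    rw [Finset.sum_comm]; exact Finset.sum_congr rfl fun z _ => by rw [← hsatC z, Finset.sum_mul]
  have h3 : ∑ x, (νN x - ∑ y, rA y x - ∑ z, rC x z) * wN x =
      (∑ x, νN x * wN x) - (∑ y, ∑ x, rA y x * wN x) - ∑ x, ∑ z, rC x z * wN x := by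
    rw [Finset.sum_comm (f := fun y x => rA y x * wN x), ← Finset.sum_sub_distrib, ← Finset.sum_sub_distrib]
    exact Finset.sum_congr rfl fun x _ => by rw [sub_mul, sub_mul, Finset.sum_mul, Finset.sum_mul]
  have h4 : ∑ y, ∑ x, rA y x * (wA y - wN x) = (∑ y, ∑ x, rA y x * wA y) - ∑ y, ∑ x, rA y x * wN x := by
    rw [← Finset.sum_sub_distrib]; refine Finset.sum_congr rfl fun y _ => ?_
    rw [← Finset.sum_sub_distrib]; exact Finset.sum_congr rfl fun x _ => by ring
  have h5 : ∑ x, ∑ z, rC x z * (wN x - wC z) = (∑ x, ∑ z, rC x z * wN x) - ∑ x, ∑ z, rC x z * wC z := by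
    rw [← Finset.sum_sub_distrib]; refine Finset.sum_congr rfl fun x _ => ?_
    rw [← Finset.sum_sub_distrib]; exact Finset.sum_congr rfl fun z _ => by ring
  rw [h1, h2, h3, h4, h5]; ring

end Smeared

end Summit.HodgeConjecture.HodgeConjecture.Cruxes.BlochSeedDiscOne.PhaseTorus
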